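import Summits.ValiantsHypothesis.ValiantsHypothesis.Theorems.MatrixDescartes.Negative.MatrixDescartesWitness24

/-!
# `MatrixDescartes` census — normal form of the exponents: rows reduce to STRICTLY INCREASING supports `0 = d₀ < d₁ < ⋯`

HONEST FRAMING.  Object-search cell `pub-symmetroid`, crux `Theses.LacunarySymmetroid.MatrixDescartes`
(stmt-ValiantsHypothesis-18050).  The census, its upper-bound TABLE (DATA-CUT item (b)) and every kernel support
certificate (`Census.posRoots_le_19_on_2_6_<d>`, …) index SUPPORTS in normal form `0 = d₀ < d₁ < ⋯ < d_{K−1}`, whereas the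
row predicate `PosRootLawAt m K B` («`ζ_sym(m,K) ≤ B`») and the cell's theorem targets (`DoorA26 = PosRootLawAt 2 6 19`,
`DoorA34 = PosRootLawAt 3 4 18`) quantify over ALL exponent vectors `d : Fin K → ℕ`, as the crux does.  This file is the
elementary glue: for `K ≥ 1`,

  `PosRootLawAt m K B ↔ ∀ d, StrictMono d → d 0 = 0 → (∀ S symmetric, #Z₊(det ∑ X^(d l) • S l) ≤ B)`

(`posRootLawAt_iff_strictMono`).  Proof: collect the coefficients of coincident exponents (a sum of symmetric matrices is
symmetric), pad with zero coefficients on fresh exponents, enumerate the resulting support increasingly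
(`Finset.orderEmbOfFin`), and divide the determinant by `X^(m·min d)`, which does not move positive roots
(`exists_strictMono_pencil`, `posRoots_X_pow_mul_eq`).  Nothing here is specific to `m = 2`; nothing is claimed about
the crux or about `VP ≠ VNP`.

[folklore] Elementary bookkeeping.
-/

-- `Summit.ValiantsHypothesis.ValiantsHypothesis.…` repeats a component by the D-0017 layout
-- (single-conjunct summit), which the `dupNamespace` linter flags; the name is mandated.
set_option linter.dupNamespace false

namespace Summit.ValiantsHypothesis.ValiantsHypothesis.Theorems.LacunarySymmetroidMatrixDescartes.Census

open Polynomial Finset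
open scoped BigOperators Polynomial Matrix
open Summit.ValiantsHypothesis.ValiantsHypothesis.Theorems.MatrixDescartes.Negative (PosRootLawAt)

/-- Positive roots are unchanged by a monomial factor: `Z₊(X^k · p) = Z₊(p)` as finsets (also for `p = 0`). [folklore] -/
theorem posRoots_X_pow_mul_eq (k : ℕ) (p : ℝ[X]) :
    ((X ^ k * p).roots.toFinset.filter (fun x => 0 < x)) = (p.roots.toFinset.filter (fun x => 0 < x)) := by
  by_cases hp : p = 0
  · simp [hp]
  rw [roots_mul (mul_ne_zero (pow_ne_zero _ X_ne_zero) hp), roots_X_pow, Multiset.toFinset_add,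
    Finset.filter_union]
  have : ((k • ({0} : Multiset ℝ)).toFinset.filter (fun x => 0 < x)) = ∅ := by
    refine Finset.filter_eq_empty_iff.mpr fun x hx => ?_
    rw [Multiset.mem_toFinset] at hx
    have := Multiset.mem_of_mem_nsmul hx
    rw [Multiset.mem_singleton] at this
    rw [this]; exact lt_irrefl 0
  rw [this, Finset.empty_union]

/-- `Matrix.map C` of a finite sum of real matrices. [folklore] -/
theorem map_C_sum {m : ℕ} {ι : Type*} (s : Finset ι) (S : ι → Matrix (Fin m) (Fin m) ℝ) :
    (∑ l ∈ s, S l).map (C : ℝ → ℝ[X]) = ∑ l ∈ s, (S l).map C := by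
  have h : ∀ M : Matrix (Fin m) (Fin m) ℝ, M.map (C : ℝ → ℝ[X]) = (Polynomial.C : ℝ →+* ℝ[X]).mapMatrix M :=
    fun M => rfl
  simp_rw [h, map_sum]

/-- A sum of symmetric matrices is symmetric. [folklore] -/
theorem isSymm_sum {m : ℕ} {ι : Type*} (s : Finset ι) (S : ι → Matrix (Fin m) (Fin m) ℝ)
    (hS : ∀ l ∈ s, (S l).IsSymm) : (∑ l ∈ s, S l).IsSymm := by
  unfold Matrix.IsSymm
  rw [Matrix.transpose_sum]
  exact Finset.sum_congr rfl fun l hl => hS l hl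

/-- **Normal form of the exponents.**  Every `(K+1)`-term pencil `∑ l, X^(d l) • S l` equals `X^e • ∑ j, X^(d' j) • S' j`
with `e = min d`, `d'` STRICTLY INCREASING, `d' 0 = 0`, and each new coefficient `S' j` a sub-sum of the old ones (the
coefficients of one exponent collected; zero on the padding exponents). [folklore] -/
theorem exists_strictMono_pencil {m K : ℕ} (d : Fin (K + 1) → ℕ) (S : Fin (K + 1) → Matrix (Fin m) (Fin m) ℝ) :
    ∃ (e : ℕ) (d' : Fin (K + 1) → ℕ) (S' : Fin (K + 1) → Matrix (Fin m) (Fin m) ℝ),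
      StrictMono d' ∧ d' 0 = 0 ∧ (∀ j, ∃ s : Finset (Fin (K + 1)), S' j = ∑ l ∈ s, S l) ∧
      (∑ l, (X : ℝ[X]) ^ d l • (S l).map C) = (X : ℝ[X]) ^ e • ∑ j, (X : ℝ[X]) ^ d' j • (S' j).map C := by
  -- the minimum exponent and the reduced exponents g = d - e
  obtain ⟨l₀, -, hl₀⟩ := Finset.exists_min_image Finset.univ d Finset.univ_nonempty
  set e := d l₀ with he
  have hed : ∀ l, e ≤ d l := fun l => hl₀ l (Finset.mem_univ _)
  set g : Fin (K + 1) → ℕ := fun l => d l - e with hg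
  have hdg : ∀ l, d l = g l + e := fun l => by simp only [hg]; have := hed l; omega
  -- the support s of g, its bound M, and the padded support s' of size K+1
  set s : Finset ℕ := Finset.univ.image g with hs
  have h0s : (0 : ℕ) ∈ s := Finset.mem_image.2 ⟨l₀, Finset.mem_univ _, by simp only [hg]; rw [← he]; exact Nat.sub_self e⟩
  have hgs : ∀ l, g l ∈ s := fun l => Finset.mem_image_of_mem g (Finset.mem_univ l)
  set M : ℕ := s.sup id with hM
  have hle : ∀ x ∈ s, x ≤ M := fun x hx => Finset.le_sup (f := id) hx
  have hcard_le : s.card ≤ K + 1 := Finset.card_image_le.trans (by simp)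
  set n : ℕ := K + 1 - s.card with hn
  set pad : Finset ℕ := Finset.Ioc M (M + n) with hpad
  have hdisj : Disjoint s pad := by
    rw [Finset.disjoint_left]
    intro x hx hx'
    rw [hpad, Finset.mem_Ioc] at hx'
    exact absurd (hle x hx) (not_le.2 hx'.1)
  set s' : Finset ℕ := s ∪ pad with hs'
  have hcard : s'.card = K + 1 := by
    rw [hs', Finset.card_union_of_disjoint hdisj, hpad, Nat.card_Ioc]
    omega
  have hss' : ∀ l, g l ∈ s' := fun l => Finset.mem_union_left _ (hgs l)
  have h0s' : (0 : ℕ) ∈ s' := Finset.mem_union_left _ h0s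
  -- the increasing enumeration of s' and the collected coefficients
  let ε : Fin (K + 1) ↪o ℕ := s'.orderEmbOfFin hcard
  let T : ℕ → Matrix (Fin m) (Fin m) ℝ := fun v => ∑ l ∈ Finset.univ.filter (fun l => g l = v), S l
  refine ⟨e, ε, fun j => T (ε j), ε.strictMono, ?_, fun j => ⟨_, rfl⟩, ?_⟩
  · -- ε 0 = min s' = 0
    have hz := Finset.orderEmbOfFin_zero hcard (Nat.succ_pos K)
    have hmin : s'.min' (Finset.card_pos.mp (hcard.symm ▸ Nat.succ_pos K)) ≤ 0 := Finset.min'_le s' 0 h0s'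
    have h00 : ((⟨0, Nat.succ_pos K⟩ : Fin (K + 1)) : Fin (K + 1)) = 0 := rfl
    rw [h00] at hz
    rw [hz]
    exact Nat.le_zero.1 hmin
  · -- the identity of pencils
    have hL : (∑ l, (X : ℝ[X]) ^ d l • (S l).map C) = (X : ℝ[X]) ^ e • ∑ l, (X : ℝ[X]) ^ g l • (S l).map C := by
      rw [Finset.smul_sum]
      refine Finset.sum_congr rfl fun l _ => ?_
      rw [smul_smul, ← pow_add, hdg l, Nat.add_comm]
    rw [hL]
    congr 1
    -- ∑ j, F (ε j) = ∑ v ∈ s', F v = ∑ v ∈ s', ∑ (fiber) = ∑ l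
    have hR : (∑ j, (X : ℝ[X]) ^ (ε j) • (T (ε j)).map C) = ∑ v ∈ s', (X : ℝ[X]) ^ v • (T v).map C := by
      have := (Finset.sum_map Finset.univ ε.toEmbedding (fun v => (X : ℝ[X]) ^ v • (T v).map C)).symm
      rw [Finset.map_orderEmbOfFin_univ] at this
      simpa using this
    rw [hR]
    have hF : ∀ v ∈ s', (X : ℝ[X]) ^ v • (T v).map C
        = ∑ l ∈ Finset.univ.filter (fun l => g l = v), (X : ℝ[X]) ^ g l • (S l).map C := by
      intro v _
      simp only [T]
      rw [map_C_sum, Finset.smul_sum]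
      refine Finset.sum_congr rfl fun l hl => ?_
      rw [(Finset.mem_filter.1 hl).2]
    rw [Finset.sum_congr rfl hF]
    exact (Finset.sum_fiberwise_of_maps_to (fun l _ => hss' l) _).symm

/-- **Rows reduce to normal-form supports.**  For `K ≥ 1`: `ζ_sym(m,K) ≤ B` iff the bound holds on every STRICTLY
INCREASING exponent vector with `d 0 = 0` — the supports the census and its certificate table enumerate. [folklore] -/
theorem posRootLawAt_iff_strictMono (m K B : ℕ) :
    PosRootLawAt m (K + 1) B ↔
      ∀ d : Fin (K + 1) → ℕ, StrictMono d → d 0 = 0 →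
        ∀ S : Fin (K + 1) → Matrix (Fin m) (Fin m) ℝ, (∀ l, (S l).IsSymm) →
          ((∑ l, (X : ℝ[X]) ^ d l • (S l).map C).det.roots.toFinset.filter (fun t => 0 < t)).card ≤ B := by
  constructor
  · exact fun h d _ _ S hS => h d S hS
  · intro h d S hS
    obtain ⟨e, d', S', hmono, h0, hsub, heq⟩ := exists_strictMono_pencil d S
    have hS' : ∀ j, (S' j).IsSymm := by
      intro j
      obtain ⟨s, hs⟩ := hsub j
      rw [hs]
      exact isSymm_sum s S fun l _ => hS l
    rw [heq, Matrix.det_smul, Fintype.card_fin, ← pow_mul, posRoots_X_pow_mul_eq]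
    exact h d' hmono h0 S' hS'

/-! ## Appended (typer gen 5, same day): PRIMITIVE supports — dividing the exponents by their gcd (`x ↦ x^(1/g)`) -/

/-- The pencil on the exponents `g · d` has determinant `expand g` of the determinant on `d`. [folklore] -/
theorem det_pencil_mul_eq_expand {m K : ℕ} (g : ℕ) (d : Fin K → ℕ) (S : Fin K → Matrix (Fin m) (Fin m) ℝ) :
    (∑ l, (X : ℝ[X]) ^ (g * d l) • (S l).map C).det
      = expand ℝ g ((∑ l, (X : ℝ[X]) ^ d l • (S l).map C).det) := by
  rw [AlgHom.map_det, map_sum]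
  congr 1
  refine Finset.sum_congr rfl fun l _ => ?_
  rw [AlgHom.mapMatrix_apply, Matrix.map_smul' _ _ _ (fun a b => map_mul (expand ℝ g) a b), Matrix.map_map,
    map_pow, expand_X, ← pow_mul]
  congr 1
  funext i j
  simp [Matrix.map_apply]

/-- Positive roots of `expand g p` (`g ≥ 1`) are in bijection with those of `p` under `t ↦ t^g`: same count. [folklore] -/
theorem card_posRoots_expand (g : ℕ) (hg : 0 < g) (p : ℝ[X]) :
    ((expand ℝ g p).roots.toFinset.filter (fun x => 0 < x)).card
      = (p.roots.toFinset.filter (fun x => 0 < x)).card := by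
  by_cases hp : p = 0
  · simp [hp]
  have hep : expand ℝ g p ≠ 0 := fun h => hp ((expand_eq_zero hg).1 h)
  have memA : ∀ t : ℝ, t ∈ ((expand ℝ g p).roots.toFinset.filter (fun x => 0 < x)) ↔ eval (t ^ g) p = 0 ∧ 0 < t :=
    fun t => by rw [Finset.mem_filter, Multiset.mem_toFinset, mem_roots hep, IsRoot.def, expand_eval]
  have memB : ∀ u : ℝ, u ∈ (p.roots.toFinset.filter (fun x => 0 < x)) ↔ eval u p = 0 ∧ 0 < u :=
    fun u => by rw [Finset.mem_filter, Multiset.mem_toFinset, mem_roots hp, IsRoot.def]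
  refine Finset.card_nbij (fun t => t ^ g) ?_ ?_ ?_
  · intro t ht
    have ht' := (memA t).1 (Finset.mem_coe.1 ht)
    exact Finset.mem_coe.2 ((memB _).2 ⟨ht'.1, pow_pos ht'.2 g⟩)
  · intro t₁ ht₁ t₂ ht₂ h
    have h₁ := ((memA t₁).1 (Finset.mem_coe.1 ht₁)).2
    have h₂ := ((memA t₂).1 (Finset.mem_coe.1 ht₂)).2
    exact (pow_left_strictMonoOn₀ hg.ne').injOn h₁.le h₂.le h
  · intro u hu
    have hu' := (memB u).1 (Finset.mem_coe.1 hu)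
    refine ⟨u ^ ((g : ℝ)⁻¹), ?_, Real.rpow_inv_natCast_pow hu'.2.le hg.ne'⟩
    refine Finset.mem_coe.2 ((memA _).2 ⟨?_, Real.rpow_pos_of_pos hu'.2 _⟩)
    rw [Real.rpow_inv_natCast_pow hu'.2.le hg.ne']
    exact hu'.1

/-- **Rows reduce to PRIMITIVE normal-form supports** (`K ≥ 2` terms): `ζ_sym(m,K) ≤ B` iff the bound holds on every
strictly increasing exponent vector with `d 0 = 0` AND `gcd (d 0, …, d (K−1)) = 1` — exactly the supports the census
enumerates (substitute `x ↦ x^(1/g)`, a bijection of `(0, ∞)`). [folklore] -/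
theorem posRootLawAt_iff_primitive (m K B : ℕ) :
    PosRootLawAt m (K + 2) B ↔
      ∀ d : Fin (K + 2) → ℕ, StrictMono d → d 0 = 0 → Finset.univ.gcd d = 1 →
        ∀ S : Fin (K + 2) → Matrix (Fin m) (Fin m) ℝ, (∀ l, (S l).IsSymm) →
          ((∑ l, (X : ℝ[X]) ^ d l • (S l).map C).det.roots.toFinset.filter (fun t => 0 < t)).card ≤ B := by
  rw [posRootLawAt_iff_strictMono]
  constructor
  · exact fun h d hd h0 _ S hS => h d hd h0 S hS
  · intro h d hd h0 S hS
    -- the gcd G of the exponents is positive since d 1 > d 0 = 0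
    set G : ℕ := Finset.univ.gcd d with hG
    have hd1 : d 1 ≠ 0 := by
      have := hd (show (0 : Fin (K + 2)) < 1 from Fin.zero_lt_one)
      omega
    have hG0 : G ≠ 0 := fun h0' => hd1 ((Finset.gcd_eq_zero_iff.1 h0') 1 (Finset.mem_univ _))
    have hGpos : 0 < G := Nat.pos_of_ne_zero hG0
    -- the primitive exponents d' = d / G
    set d' : Fin (K + 2) → ℕ := fun l => d l / G with hd'
    have hdvd : ∀ l, G ∣ d l := fun l => Finset.gcd_dvd (Finset.mem_univ l)
    have hdd' : ∀ l, d l = G * d' l := fun l => (Nat.mul_div_cancel' (hdvd l)).symm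
    have hd'mono : StrictMono d' := by
      intro a b hab
      have := hd hab
      rw [hdd' a, hdd' b] at this
      exact Nat.lt_of_mul_lt_mul_left this
    have hd'0 : d' 0 = 0 := by simp [hd', h0]
    have hd'gcd : Finset.univ.gcd d' = 1 := by
      simp only [hd', hG]
      exact Finset.gcd_div_eq_one (Finset.mem_univ (1 : Fin (K + 2))) hd1
    have hdet : (∑ l, (X : ℝ[X]) ^ d l • (S l).map C).det
        = expand ℝ G ((∑ l, (X : ℝ[X]) ^ d' l • (S l).map C).det) := by
      rw [← det_pencil_mul_eq_expand]
      simp_rw [← hdd']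
    rw [hdet, card_posRoots_expand G hGpos]
    exact h d' hd'mono hd'0 hd'gcd S hS

end Summit.ValiantsHypothesis.ValiantsHypothesis.Theorems.LacunarySymmetroidMatrixDescartes.Census
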